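import Summits.CriticalPhenomena.PercolationContinuityZ3.Theorems.PercNearOneGluingNoHeavyLowerTailSahiOneStepUpperMonoA
import Summits.CriticalPhenomena.PercolationContinuityZ3.Theorems.PercNearOneGluingNoHeavyLowerTailSahiOneStepDisjointOr
import HarnessLib

/-!
# Two-sided lumping with a free block — LEMMA U: positive stability of the level coefficients (log-concavity of the free block)

Support file (prover prim-ineq-prove-3 gen 53; `--supports stmt-CriticalPhenomena-4575`; memo
`run/shared/lean/prim/prim-ineq-prove-3/PROOF-G53-TL-FREE-BLOCK.md` §2).  No definitions, no named facts, no sorries, no `native_decide`.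

Abstract setting (hypotheses fixing the formulae, no definitions): a log-concave sequence `q` (the level law of the free block, `q j = μ{#(R∩ω) = j}`),
positive on `[0, N]` and zero above `N`, its upper tails `up m = Σ_{j ≥ m} q j` (`up m = q m + up (m+1)`, `up 0 = 1`), levels `t ≤ s`, and reals
`0 ≤ aL ≤ a ≤ aU ≤ 1`.  The level coefficients of the two-sided lumping functional in its second argument are
`Cout k = aL·(1 − up (t−k)) + aU·up (s−k) − a` (points outside `A`) and `Cin k = Cout k + (up (t−k) − up (s−k))` (points of `A`).
* `levelCoeff_out_pos_stable` — `0 < Cout k → k ≤ k' → 0 < Cout k'`;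
* `levelCoeff_in_nonneg_stable` — `0 < Cin k → k ≤ k' → 0 ≤ Cin k'`.
(Memo §2: the sign of the increment `aU·q(s−1−k) − aL·q(t−1−k)` is monotone in `k` by log-concavity, and a negative increment at a positive value
is impossible by a termwise tail comparison.)  §3 instantiates `q, up` with the layer law of a block `R` at densities in `(0,1)`
(`isLogConcaveSeq_real_layer`, `real_layer_pos`, `real_upper_succ`): `levelCoeff_out_pos_stable_layer`, `levelCoeff_in_nonneg_stable_layer`.
-/

noncomputable section

namespace Summit.CriticalPhenomena.PercolationContinuityZ3.Theorems

namespace SahiOneStep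

open MeasureTheory Finset
open Literature.Probability.Distributions (IsLogConcaveSeq)
open Literature.Probability.LatticeModels (prodBernoulli)
open scoped Classical

variable {ι : Type*} [Fintype ι]

section abstract

variable {q up : ℕ → ℝ} {N t s : ℕ}
  (hq : IsLogConcaveSeq q) (hqpos : ∀ j, j ≤ N → 0 < q j) (hqN : ∀ j, N < j → q j = 0)
  (hstep : ∀ m, up m = q m + up (m + 1)) (hupN : ∀ m, N < m → up m = 0) (hup0 : up 0 = 1) (hts : t ≤ s)
include hq hqpos hqN hstep hupN hup0 hts

omit [Fintype ι] hqpos hqN hup0 hts in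
/-- `up` is a sum of nonnegative terms. [folklore] -/
theorem up_nonneg : ∀ m, 0 ≤ up m := by
  suffices h : ∀ c m, N + 1 ≤ m + c → 0 ≤ up m from fun m => h (N + 1) m (by omega)
  intro c
  induction c with
  | zero => intro m hm; rw [hupN m (by omega)]
  | succ c ih =>
    intro m hm
    by_cases hmN : N < m
    · rw [hupN m hmN]
    · rw [hstep m]; exact add_nonneg (hq.nonneg m) (ih (m + 1) (by omega))

omit [Fintype ι] hqpos hqN hupN hup0 hts in
/-- `up` is non-increasing by one step. [folklore] -/
theorem up_succ_le (m : ℕ) : up (m + 1) ≤ up m := by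
  rw [hstep m]; linarith [hq.nonneg m]

omit [Fintype ι] hqpos hqN hupN hup0 hts in
/-- `up` is antitone. [folklore] -/
theorem up_antitone {m m' : ℕ} (h : m ≤ m') : up m' ≤ up m := by
  induction h with
  | refl => exact le_rfl
  | step _ ih => exact (up_succ_le hq hstep _).trans ih

omit [Fintype ι] hqpos hqN hupN hts in
/-- `up m ≤ 1`. [folklore] -/
theorem up_le_one (m : ℕ) : up m ≤ 1 := by
  have := up_antitone hq hstep (Nat.zero_le m); rwa [hup0] at this

omit [Fintype ι] hq hqpos hqN hupN hts in
/-- The lower sum: `1 − up m = Σ_{j<m} q j`. [folklore] -/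
theorem one_sub_up_eq_sum (m : ℕ) : 1 - up m = ∑ j ∈ range m, q j := by
  induction m with
  | zero => rw [hup0, sum_range_zero]; ring
  | succ m ih => rw [sum_range_succ, ← ih, hstep m]; ring

omit [Fintype ι] hq hqpos hqN hup0 hts in
/-- **Termwise-to-tail comparison**: if `α·q(i+d) ≤ β·q(i)` for all `i ≥ m₀` then `α·up(m+d) ≤ β·up m` for all `m ≥ m₀`. [this work] -/
theorem tail_le_of_termwise {α β : ℝ} (d m₀ : ℕ) (h : ∀ i, m₀ ≤ i → α * q (i + d) ≤ β * q i) :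
    ∀ m, m₀ ≤ m → α * up (m + d) ≤ β * up m := by
  suffices key : ∀ c m, N + 1 ≤ m + c → m₀ ≤ m → α * up (m + d) ≤ β * up m from fun m hm => key (N + 1) m (by omega) hm
  intro c
  induction c with
  | zero => intro m hc hm; rw [hupN m (by omega), hupN (m + d) (by omega)]; simp
  | succ c ih =>
    intro m hc hm
    by_cases hmN : N < m
    · rw [hupN m hmN, hupN (m + d) (by omega)]; simp
    · rw [hstep (m + d), hstep m, show m + d + 1 = (m + 1) + d by ring, mul_add, mul_add]
      exact add_le_add (h m hm) (ih (m + 1) (by omega) (by omega))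

omit [Fintype ι] hqpos hqN hstep hupN hup0 in
/-- **Sign monotonicity of the increment** (log-concavity): if `β·q(t−1−k) ≤ α·q(s−1−k)` at some `k < t` with `q(t−1−k) > 0`, then the same holds at
every `k' ∈ [k, t)` (`α, β ≥ 0`). [this work] -/
theorem incr_sign_mono {α β : ℝ} (hα : 0 ≤ α) {k k' : ℕ} (hkk' : k ≤ k') (hk't : k' < t)
    (hpos : 0 < q (t - 1 - k)) (h : β * q (t - 1 - k) ≤ α * q (s - 1 - k)) :
    β * q (t - 1 - k') ≤ α * q (s - 1 - k') := by
  -- log-concavity: q(s−1−k)·q(t−1−k') ≤ q(t−1−k)·q(s−1−k')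
  have hlc : q (t - 1 - k') * q (s - 1 - k) ≤ q (t - 1 - k) * q (s - 1 - k') :=
    hq.mul_le_mul (a := t - 1 - k') (b := t - 1 - k) (c := s - 1 - k') (d := s - 1 - k) (by omega) (by omega) (by omega)
  have h1 : β * q (t - 1 - k') * q (t - 1 - k) ≤ α * q (s - 1 - k) * q (t - 1 - k') := by
    have := mul_le_mul_of_nonneg_right h (hq.nonneg (t - 1 - k'))
    linarith
  have h2 : α * q (s - 1 - k) * q (t - 1 - k') ≤ α * (q (t - 1 - k) * q (s - 1 - k')) := by
    have := mul_le_mul_of_nonneg_left hlc hα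
    linarith
  have h3 : β * q (t - 1 - k') * q (t - 1 - k) ≤ (α * q (s - 1 - k')) * q (t - 1 - k) := by linarith
  exact le_of_mul_le_mul_right h3 hpos

omit [Fintype ι] hq hqpos hqN hupN hup0 in
/-- The increment of `Cout` below level `t`. [this work] -/
theorem cout_succ_sub_of_lt {aL a aU : ℝ} {k : ℕ} (hkt : k < t) :
    (aL * (1 - up (t - (k + 1))) + aU * up (s - (k + 1)) - a) - (aL * (1 - up (t - k)) + aU * up (s - k) - a) =
      aU * q (s - 1 - k) - aL * q (t - 1 - k) := by
  have e1 : up (t - (k + 1)) = q (t - (k + 1)) + up (t - k) := by rw [hstep (t - (k + 1))]; congr 2; omega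
  have e2 : up (s - (k + 1)) = q (s - (k + 1)) + up (s - k) := by rw [hstep (s - (k + 1))]; congr 2; omega
  rw [e1, e2, show t - 1 - k = t - (k + 1) by omega, show s - 1 - k = s - (k + 1) by omega]; ring

omit [Fintype ι] hqpos hqN hupN hup0 hts in
/-- The increment of `Cout` at levels `≥ t` is `≥ 0`. [this work] -/
theorem cout_succ_ge_of_le {aL a aU : ℝ} (haU : 0 ≤ aU) {k : ℕ} (htk : t ≤ k) :
    aL * (1 - up (t - k)) + aU * up (s - k) - a ≤ aL * (1 - up (t - (k + 1))) + aU * up (s - (k + 1)) - a := by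
  rw [show t - (k + 1) = 0 by omega, show t - k = 0 by omega]
  have : up (s - k) ≤ up (s - (k + 1)) := up_antitone hq hstep (by omega)
  nlinarith [this, haU]

omit hqN hup0 in
/-- **KEY STEP** (memo §2(b)): a positive `Cout k` at a level `k < t` forces a nonnegative increment there. [this work] -/
theorem incr_nonneg_of_cout_pos {aL a aU : ℝ} (hLa : aL ≤ a) (haU : 0 ≤ aU) {k : ℕ} (hkt : k < t)
    (hpos : 0 < aL * (1 - up (t - k)) + aU * up (s - k) - a) :
    aL * q (t - 1 - k) ≤ aU * q (s - 1 - k) := by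
  -- the relevant level is inside the support: otherwise `Cout k = aL − a ≤ 0`
  have hkN : t - 1 - k ≤ N := by
    by_contra h
    have h1 : up (t - k) = 0 := hupN _ (by omega)
    have h2 : up (s - k) = 0 := hupN _ (by omega)
    rw [h1, h2] at hpos; linarith
  have hqk : 0 < q (t - 1 - k) := hqpos _ hkN
  by_contra hneg
  push Not at hneg
  -- termwise: aU·q(i+d) ≤ aL·q(i) for i ≥ t−1−k (d = s−t), by log-concavity and the negative increment
  have hterm : ∀ i, t - 1 - k ≤ i → aU * q (i + (s - t)) ≤ aL * q i := by
    intro i hi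
    have hlc : q (t - 1 - k) * q (i + (s - t)) ≤ q i * q (s - 1 - k) := by
      have := hq.mul_le_mul (a := t - 1 - k) (b := i) (c := s - 1 - k) (d := i + (s - t)) hi (by omega) (by omega)
      linarith [mul_comm (q i) (q (s - 1 - k))]
    have h1 : aU * q (i + (s - t)) * q (t - 1 - k) ≤ aU * (q i * q (s - 1 - k)) := by
      have := mul_le_mul_of_nonneg_left hlc haU; linarith
    have h2 : aU * (q i * q (s - 1 - k)) ≤ aL * q (t - 1 - k) * q i := by
      have := mul_le_mul_of_nonneg_right hneg.le (hq.nonneg i); linarith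
    have h3 : aU * q (i + (s - t)) * q (t - 1 - k) ≤ (aL * q i) * q (t - 1 - k) := by linarith
    exact le_of_mul_le_mul_right h3 hqk
  -- tails: aU·up(s−k) ≤ aL·up(t−k)
  have htail := tail_le_of_termwise hstep hupN (s - t) (t - 1 - k) hterm (t - k) (by omega)
  rw [show t - k + (s - t) = s - k by omega] at htail
  -- hence Cout k ≤ aL − a ≤ 0
  have : aL * (1 - up (t - k)) + aU * up (s - k) - a ≤ aL - a := by nlinarith [htail]
  linarith

omit hqN hup0 in
/-- **LEMMA U (i)** (memo §2): positive stability of the outside coefficient — `0 < Cout k → k ≤ k' → 0 < Cout k'`. [this work] -/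
theorem levelCoeff_out_pos_stable {aL a aU : ℝ} (hLa : aL ≤ a) (haU : 0 ≤ aU) {k k' : ℕ} (hkk' : k ≤ k')
    (hpos : 0 < aL * (1 - up (t - k)) + aU * up (s - k) - a) :
    0 < aL * (1 - up (t - k')) + aU * up (s - k') - a := by
  induction hkk' with
  | refl => exact hpos
  | @step k' hkk' ih =>
    by_cases hk't : k' < t
    · -- increment at k' is ≥ 0: transfer the sign from k
      have hkt : k < t := lt_of_le_of_lt hkk' hk't
      have hkN : t - 1 - k ≤ N := by
        by_contra h
        have h1 : up (t - k) = 0 := hupN _ (by omega)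
        have h2 : up (s - k) = 0 := hupN _ (by omega)
        rw [h1, h2] at hpos; linarith
      have hsign := incr_sign_mono hq hts haU hkk' hk't (hqpos _ hkN)
        (incr_nonneg_of_cout_pos hq hqpos hstep hupN hts hLa haU hkt hpos)
      have hincr := cout_succ_sub_of_lt hstep hts (aL := aL) (a := a) (aU := aU) hk't
      linarith
    · push Not at hk't
      exact lt_of_lt_of_le ih (cout_succ_ge_of_le hq hstep haU hk't)

omit hqN hupN in
/-- **KEY STEP'** (memo §2(ii)): at a level `k < t` inside the support with a nonnegative `h'`-increment
`(1−aL)q(t−1−k) ≤ (1−aU)q(s−1−k)`, one has `h'(k) = (1−aL)(1−up(t−k)) + (1−aU)up(s−k) ≤ 1 − aU`. [this work] -/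
theorem hprime_le_of_incr_nonneg {aL aU : ℝ} (haU1 : aU ≤ 1) {k : ℕ} (hkt : k < t) (hkN : t - 1 - k ≤ N)
    (h : (1 - aL) * q (t - 1 - k) ≤ (1 - aU) * q (s - 1 - k)) :
    (1 - aL) * (1 - up (t - k)) + (1 - aU) * up (s - k) ≤ 1 - aU := by
  have hqk : 0 < q (t - 1 - k) := hqpos _ hkN
  -- termwise for i ≤ t−1−k: (1−aL) q i ≤ (1−aU) q (i+d)
  have hterm : ∀ i, i ≤ t - 1 - k → (1 - aL) * q i ≤ (1 - aU) * q (i + (s - t)) := by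
    intro i hi
    have hlc : q i * q (s - 1 - k) ≤ q (t - 1 - k) * q (i + (s - t)) :=
      hq.mul_le_mul (a := i) (b := t - 1 - k) (c := i + (s - t)) (d := s - 1 - k) hi (by omega) (by omega)
    have h1 : (1 - aL) * q i * q (t - 1 - k) ≤ (1 - aU) * q (s - 1 - k) * q i := by
      have := mul_le_mul_of_nonneg_right h (hq.nonneg i); linarith
    have h2 : (1 - aU) * q (s - 1 - k) * q i ≤ (1 - aU) * (q (t - 1 - k) * q (i + (s - t))) := by
      have := mul_le_mul_of_nonneg_left hlc (sub_nonneg.2 haU1); linarith [mul_comm (q i) (q (s - 1 - k))]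
    have h3 : (1 - aL) * q i * q (t - 1 - k) ≤ ((1 - aU) * q (i + (s - t))) * q (t - 1 - k) := by linarith
    exact le_of_mul_le_mul_right h3 hqk
  -- sum over i < t−k
  have hsum1 : (1 - aL) * ∑ i ∈ range (t - k), q i ≤ (1 - aU) * ∑ i ∈ range (t - k), q (i + (s - t)) := by
    rw [mul_sum, mul_sum]
    exact sum_le_sum fun i hi => hterm i (by rw [mem_range] at hi; omega)
  -- Σ_{i<t−k} q(i+d) ≤ Σ_{j<s−k} q j
  have hsum2 : ∑ i ∈ range (t - k), q (i + (s - t)) ≤ ∑ j ∈ range (s - k), q j := by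
    rw [show s - k = (s - t) + (t - k) by omega, sum_range_add]
    have h0 : 0 ≤ ∑ j ∈ range (s - t), q j := sum_nonneg fun j _ => hq.nonneg j
    have : ∑ i ∈ range (t - k), q (i + (s - t)) = ∑ i ∈ range (t - k), q ((s - t) + i) :=
      sum_congr rfl fun i _ => by rw [add_comm]
    linarith
  rw [one_sub_up_eq_sum hstep hup0 (t - k), show up (s - k) = 1 - (1 - up (s - k)) by ring,
    one_sub_up_eq_sum hstep hup0 (s - k)]
  have h4 := mul_le_mul_of_nonneg_left hsum2 (sub_nonneg.2 haU1)
  linarith [hsum1, h4]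

omit hqN in
/-- **LEMMA U (ii)** (memo §2): weak positive stability of the inside coefficient — `0 < Cin k → k ≤ k' → 0 ≤ Cin k'`,
`Cin k = Cout k + (up(t−k) − up(s−k)) = (1−a) − [(1−aL)(1−up(t−k)) + (1−aU)up(s−k)]`. [this work] -/
theorem levelCoeff_in_nonneg_stable {aL a aU : ℝ} (hLa : aL ≤ a) (haU' : a ≤ aU) (haU1 : aU ≤ 1) {k k' : ℕ}
    (hkk' : k ≤ k') (hpos : 0 < aL * (1 - up (t - k)) + aU * up (s - k) - a + (up (t - k) - up (s - k))) :
    0 ≤ aL * (1 - up (t - k')) + aU * up (s - k') - a + (up (t - k') - up (s - k')) := by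
  -- invariant along k': (h' < 1−a) ∨ (k' < t ∧ t−1−k' ≤ N ∧ incr' ≥ 0) ∨ (t ≤ k')
  have hI : ∀ k', k ≤ k' →
      ((1 - aL) * (1 - up (t - k')) + (1 - aU) * up (s - k') < 1 - a) ∨
      (k' < t ∧ t - 1 - k' ≤ N ∧ (1 - aL) * q (t - 1 - k') ≤ (1 - aU) * q (s - 1 - k')) ∨ (t ≤ k') := by
    intro k' hkk'
    induction hkk' with
    | refl => left; linarith
    | @step k' hkk' ih =>
      by_cases hk't : k' + 1 < t
      swap
      · right; right; omega
      rcases ih with h1 | ⟨hk'lt, hk'N, hincr⟩ | h3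
      · -- h'(k') < 1 − a: the level is inside the support; split on the sign of the increment
        have hk'N : t - 1 - k' ≤ N := by
          by_contra h
          have e1 : up (t - k') = 0 := hupN _ (by omega)
          have e2 : up (s - k') = 0 := hupN _ (by omega)
          rw [e1, e2] at h1; linarith
        by_cases hincr : (1 - aL) * q (t - 1 - k') ≤ (1 - aU) * q (s - 1 - k')
        · right; left
          exact ⟨hk't, by omega, incr_sign_mono hq hts (sub_nonneg.2 haU1) (Nat.le_succ k') hk't (hqpos _ hk'N) hincr⟩
        · left
          push Not at hincr
          have e1 : up (t - (k' + 1)) = q (t - (k' + 1)) + up (t - k') := by rw [hstep (t - (k' + 1))]; congr 2; omega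
          have e2 : up (s - (k' + 1)) = q (s - (k' + 1)) + up (s - k') := by rw [hstep (s - (k' + 1))]; congr 2; omega
          rw [e1, e2, show t - (k' + 1) = t - 1 - k' by omega, show s - (k' + 1) = s - 1 - k' by omega]
          nlinarith [hincr, h1]
      · right; left
        exact ⟨hk't, by omega, incr_sign_mono hq hts (sub_nonneg.2 haU1) (Nat.le_succ k') hk't (hqpos _ hk'N) hincr⟩
      · right; right; omega
  rcases hI k' hkk' with h1 | ⟨hk'lt, hk'N, hincr⟩ | h3
  · linarith
  · have := hprime_le_of_incr_nonneg hq hqpos hstep hup0 hts haU1 hk'lt hk'N hincr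
    nlinarith [this]
  · rw [show t - k' = 0 by omega, hup0]
    have hu1 := up_le_one hq hstep hup0 (s - k')
    have hu0 := up_nonneg hq hstep hupN (s - k')
    nlinarith [hu1, hu0, sub_nonneg.2 haU1]

end abstract

/-! ## §3 Instantiation with the level law of a free block -/

omit [Fintype ι] in
/-- A layer above the block size has measure zero. [folklore] -/
theorem real_layer_eq_zero_of_lt (p : ι → unitInterval) (R : Finset ι) {j : ℕ} (hj : R.card < j) :
    (prodBernoulli p).real {ω : Set ι | (R.filter (· ∈ ω)).card = j} = 0 := by
  rw [layer_eq_empty_of_card_lt R hj, measureReal_empty]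

/-- **LEMMA U (i) for a free block** `R` at densities in `(0,1)`, levels `t ≤ s`, `0 ≤ aL ≤ a`, `0 ≤ aU`:
`0 < Cout k → k ≤ k' → 0 < Cout k'` with `Cout k = aL·(1 − μ{t−k ≤ N_R}) + aU·μ{s−k ≤ N_R} − a`. [this work] -/
theorem levelCoeff_out_pos_stable_layer (p : ι → unitInterval) (R : Finset ι) (hp : ∀ i ∈ R, 0 < (p i : ℝ) ∧ (p i : ℝ) < 1)
    {t s : ℕ} (hts : t ≤ s) {aL a aU : ℝ} (hLa : aL ≤ a) (haU : 0 ≤ aU) {k k' : ℕ} (hkk' : k ≤ k')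
    (hpos : 0 < aL * (1 - (prodBernoulli p).real {ω : Set ι | t - k ≤ (R.filter (· ∈ ω)).card})
      + aU * (prodBernoulli p).real {ω : Set ι | s - k ≤ (R.filter (· ∈ ω)).card} - a) :
    0 < aL * (1 - (prodBernoulli p).real {ω : Set ι | t - k' ≤ (R.filter (· ∈ ω)).card})
      + aU * (prodBernoulli p).real {ω : Set ι | s - k' ≤ (R.filter (· ∈ ω)).card} - a :=
  levelCoeff_out_pos_stable (q := fun j => (prodBernoulli p).real {ω : Set ι | (R.filter (· ∈ ω)).card = j})
    (up := fun m => (prodBernoulli p).real {ω : Set ι | m ≤ (R.filter (· ∈ ω)).card}) (N := R.card)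
    (isLogConcaveSeq_real_layer p R) (fun j hj => real_layer_pos p R hp hj)
    (fun m => by rw [real_upper_succ p R m, add_comm]) (fun m hm => by rw [threshold_eq_empty_of_card_lt R hm, measureReal_empty])
    hts hLa haU hkk' hpos

/-- **LEMMA U (ii) for a free block**: `0 < Cin k → k ≤ k' → 0 ≤ Cin k'` with
`Cin k = Cout k + (μ{t−k ≤ N_R} − μ{s−k ≤ N_R})`, `aL ≤ a ≤ aU ≤ 1`, `aL ≤ 1`. [this work] -/
theorem levelCoeff_in_nonneg_stable_layer (p : ι → unitInterval) (R : Finset ι) (hp : ∀ i ∈ R, 0 < (p i : ℝ) ∧ (p i : ℝ) < 1)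
    {t s : ℕ} (hts : t ≤ s) {aL a aU : ℝ} (hLa : aL ≤ a) (haU' : a ≤ aU) (haU1 : aU ≤ 1) {k k' : ℕ} (hkk' : k ≤ k')
    (hpos : 0 < aL * (1 - (prodBernoulli p).real {ω : Set ι | t - k ≤ (R.filter (· ∈ ω)).card})
      + aU * (prodBernoulli p).real {ω : Set ι | s - k ≤ (R.filter (· ∈ ω)).card} - a
      + ((prodBernoulli p).real {ω : Set ι | t - k ≤ (R.filter (· ∈ ω)).card}
          - (prodBernoulli p).real {ω : Set ι | s - k ≤ (R.filter (· ∈ ω)).card})) :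
    0 ≤ aL * (1 - (prodBernoulli p).real {ω : Set ι | t - k' ≤ (R.filter (· ∈ ω)).card})
      + aU * (prodBernoulli p).real {ω : Set ι | s - k' ≤ (R.filter (· ∈ ω)).card} - a
      + ((prodBernoulli p).real {ω : Set ι | t - k' ≤ (R.filter (· ∈ ω)).card}
          - (prodBernoulli p).real {ω : Set ι | s - k' ≤ (R.filter (· ∈ ω)).card}) :=
  levelCoeff_in_nonneg_stable (q := fun j => (prodBernoulli p).real {ω : Set ι | (R.filter (· ∈ ω)).card = j})
    (up := fun m => (prodBernoulli p).real {ω : Set ι | m ≤ (R.filter (· ∈ ω)).card}) (N := R.card)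
    (isLogConcaveSeq_real_layer p R) (fun j hj => real_layer_pos p R hp hj)
    (fun m => by rw [real_upper_succ p R m, add_comm]) (fun m hm => by rw [threshold_eq_empty_of_card_lt R hm, measureReal_empty])
    (by rw [threshold_zero, probReal_univ]) hts hLa haU' haU1 hkk' hpos

end SahiOneStep

end Summit.CriticalPhenomena.PercolationContinuityZ3.Theorems
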